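import Mathlib
import Literature.AlgebraicGeometry.Resolution.CobordantGame
import Literature.AlgebraicGeometry.Resolution.CobordantChartCoefficients
import Literature.AlgebraicGeometry.Resolution.CobordantTupleGame
import Literature.AlgebraicGeometry.Resolution.FormalCoordinateChange
import Summits.ResolutionOfSingularities.ResolutionOfSingularities.Theorems.WeightedInvariantLocalWeightedDropMonicLift
import Summits.ResolutionOfSingularities.ResolutionOfSingularities.Theorems.WeightedInvariantLocalWeightedDropTangentConeCut
import Summits.ResolutionOfSingularities.ResolutionOfSingularities.Theorems.WeightedInvariantLocalWeightedDropWildTerminalCalculus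
import Summits.ResolutionOfSingularities.ResolutionOfSingularities.Theorems.WeightedInvariantLocalWeightedDropWildTerminalApex
import Summits.ResolutionOfSingularities.ResolutionOfSingularities.Theorems.WeightedInvariantLocalWeightedDropWildTerminalStep

/-!
# `WeightedInvariant.LocalWeightedDrop`, line `hasse-ridge-face-selection`: THE TERMINAL PURELY INSEPARABLE SURFACE FORMS
# `y^d + A₀(x₁,x₂)` ARE WON (candidate piece S3πT of the S3 cut, every `d ≥ 2`, every characteristic)

Crux item stmt-ResolutionOfSingularities-8899 `LocalWeightedDrop` (route `ResolutionOfSingularities/WeightedInvariant`),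
serving the door `WeightedConstruction` stmt-ResolutionOfSingularities-0571.  [OURS · L1 W4.3, chain w43, stub worker 1
(gen 2).  Not a statement of any manuscript; the MATHEMATICS is the «terminal cases» step of Hauser–Perlega, PRIMS 60
(2024) §3 p. 775 and Prop. 2 p. 787 (there for `d = p^e` with a boundary), here run as a positional strategy of the local
weighted resolution game for every degree `d ≥ 2`.]

THEOREM `stub_wildPurelyInseparableTerminalWon` (the candidate stub S3πT of plan-1's skeleton drafts v22–v24, BY NAME AND
SIGNATURE): over a field of characteristic `p`, for `d ≥ 2`, given that the singular
surface germs of order `< d` are won, the monic germ `y^d + A₀(x₁,x₂)` with `ord A₀ > d` is won whenever `A₀` is TERMINAL: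
MONOMIAL CASE `A₀ = x₁^r x₂^s · U`, `U(0) ≠ 0`, `(r,s) ∉ d·ℕ²`, or SMALL RESIDUAL CASE `A₀ = x_i^{dm} · g`, `m ≥ 1`,
`0 < ord g < d`.  (= the candidate stub `stub_wildPurelyInseparableTerminalWon` of the S3 cut VERBATIM; at `d = p = 2` it is
v21's S2iT `stub_charTwoInseparableTerminalWon`.)

STRATEGY (`monicFormsWon_of_rankOn` on the class of terminal tuples `(A₀, 0, …, 0)`, rank `κ = ord A₀`, no re-centring):
* small residual `x_i^{dm} g`: blow up the curve `V(x_i, y)` (`won_monic_of_curveBlowup`); the slice at the only exceptional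
  point type is `y^d + x₁'^{d(m-1)} · g'` with `ord g' ≤ ord g < d` (`WildTerminal.order_slice_subst_axisChart_lt`): small
  residual with `m - 1`, or of order `< d` when `m = 1`;
* monomial `x₁^r x₂^s U` with `r ≥ d` (resp. `s ≥ d`): blow up `V(x₁, y)` (resp. `V(x₂, y)`): the slice is the monomial
  case `(r - d, s)` (resp. `(s - d, r)`);
* monomial with `r, s < d` (so `d < r + s < 2d`): blow up the point (`won_monic_of_pointBlowup`): at an exceptional point with
  both `c₁, c₂ ≠ 0` the slice is `y^d + s^{r+s-d} · unit`, of order `r + s - d < d`; with `c₂ = 0` it is the monomial case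
  `(r+s-d, s)`, with `c₁ = 0` the case `(r+s-d, r)`;
* EXITS: a slice `y^d + A₀'` with `ord A₀' < d` has order `< d`; with `ord A₀' = d` (monomial case `a + b = d`, `a, b ≥ 1`)
  its cone `y^d + λ x₁^a x₂^b` has trivial apex (`WildTerminal.exists_initEval_add_ne_of_monomialUnit`) and
  `TangentConeCut.apexFreeStartsWon` wins it from the germs of order `< d`; with `ord A₀' > d` it is a terminal position of
  smaller rank.
-/

set_option linter.dupNamespace false -- mandated namespace of this single-conjunct summit

namespace Summit.ResolutionOfSingularities.ResolutionOfSingularities.Theorems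

open Literature.AlgebraicGeometry.Resolution
open Literature.AlgebraicGeometry.Resolution.CobordantGame


open WildTerminal MvPowerSeries in
/-- S3πT — THE TERMINAL PURELY INSEPARABLE SURFACE FORMS ARE WON (stub `stub_wildPurelyInseparableTerminalWon` of the S3
cut / skeleton draft v22–v24 of plan-1, BY NAME AND SIGNATURE; see the module docstring).  Over a field of characteristic `p`, for every `d ≥ 2`, given that the
singular surface germs of order `< d` are won, `y^d + A₀(x₁,x₂)` with `ord A₀ > d` is won whenever `A₀ = x₁^r x₂^s · U`
(`U(0) ≠ 0`, `(r,s) ∉ d·ℕ²`) or `A₀ = x_i^{dm} · g` (`m ≥ 1`, `0 < ord g < d`).  [OURS · L1 W4.3; the mathematics: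
Hauser–Perlega, PRIMS 60 (2024) §3 Prop. 2, as a positional strategy of the local weighted resolution game.] -/
theorem stub_wildPurelyInseparableTerminalWon : ∀ (p : ℕ), p.Prime → ∀ (k : Type) [Field k] [CharP k p] [IsAlgClosed k],
      ∀ (d : ℕ), 2 ≤ d →
      (∀ g : MvPowerSeries (Fin 3) k, CobordantGame.IsSingular k g → g.order < d →
        CobordantGame.Won k 3 g) →
      ∀ (A₀ : MvPowerSeries (Fin 2) k), (d : ℕ∞) < A₀.order →
        ((∃ (r s : ℕ) (U : MvPowerSeries (Fin 2) k), MvPowerSeries.constantCoeff U ≠ 0 ∧ ¬ (d ∣ r ∧ d ∣ s) ∧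
            A₀ = MvPowerSeries.X (0 : Fin 2) ^ r * MvPowerSeries.X (1 : Fin 2) ^ s * U) ∨
          (∃ (i : Fin 2) (m : ℕ) (g : MvPowerSeries (Fin 2) k), 0 < m ∧ 0 < g.order ∧ g.order < d ∧
            A₀ = MvPowerSeries.X i ^ (d * m) * g)) →
        CobordantGame.Won k 3 (MvPowerSeries.X (Fin.last 2) ^ d +
          MvPowerSeries.rename (Fin.succAboveEmb (Fin.last 2)) A₀) := by
  intro p hp k _ _ _ d h2d hord A₀ hA₀ hterm
  classical
  have hd : 0 < d := by omega
  -- the lift on the class of terminal tuples `(A₀, 0, …, 0)`, exits = order drop / apex-free cone, rank = `ord A₀`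
  have key := monicFormsWon_of_rankOn p hp k 2 d hd
    (fun A => (∀ j : Fin d, (j : ℕ) ≠ 0 → A j = 0) ∧
      ((∃ (r s : ℕ) (U : MvPowerSeries (Fin 2) k), constantCoeff U ≠ 0 ∧ ¬ (d ∣ r ∧ d ∣ s) ∧
          A ⟨0, hd⟩ = X (0 : Fin 2) ^ r * X (1 : Fin 2) ^ s * U) ∨
        (∃ (i : Fin 2) (m : ℕ) (g : MvPowerSeries (Fin 2) k), 0 < m ∧ 0 < g.order ∧ g.order < d ∧
          A ⟨0, hd⟩ = X i ^ (d * m) * g)))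
    (fun S => S.order < d ∨ (S.order = d ∧ ∀ c : Fin (2 + 1) → k, c ≠ 0 → ∃ v : Fin (2 + 1) → k,
      CobordantChart.initEval (fun _ : Fin (2 + 1) => 1) (v + c) d S ≠
        CobordantChart.initEval (fun _ : Fin (2 + 1) => 1) v d S))
    ?hE (fun A => ((A ⟨0, hd⟩).order.toNat : Ordinal.{0})) ?hstep
    (fun j : Fin d => if (j : ℕ) = 0 then A₀ else 0)
    ⟨fun j hj => tuple_apply_ne A₀ j hj, by rw [if_pos rfl]; exact hterm⟩
    (polyhedron_of_vanish hd _ (fun j hj => tuple_apply_ne A₀ j hj) (by rw [if_pos rfl]; exact hA₀))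
  · rw [monicForm_eq_of_vanish hd _ (fun j hj => tuple_apply_ne A₀ j hj), if_pos rfl] at key
    exact key
  case hE =>
    intro S hS hES
    rcases hES with hlt | ⟨hSd, hapex⟩
    · exact hord S hS hlt
    · exact TangentConeCut.apexFreeStartsWon p hp k (by norm_num) S d hSd
        (fun g hg hlt => hord g hg (by rw [hSd] at hlt; exact hlt)) hapex
  case hstep =>
    intro A hQ hApoly
    obtain ⟨hvan, hterm'⟩ := hQ
    have hpoly0 : (d : ℕ∞) < (A ⟨0, hd⟩).order := by simpa using hApoly ⟨0, hd⟩
    refine ⟨X, A, fun i => constantCoeff_X i, (TangentConeCut.isMove_X_one (by norm_num : 0 < 2 + 1)).2.1,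
      by rw [subst_self]; rfl, hApoly, ?_⟩
    dsimp only
    rcases hterm' with ⟨r, s, U, hU, hndvd, hA0eq⟩ | ⟨i, m, g, hm, hg0, hgd, hA0eq⟩
    · ------------------------------------------------------------------ the MONOMIAL case
      have hA0ne : A ⟨0, hd⟩ ≠ 0 := by rw [hA0eq]; exact monomialUnit_ne_zero r s hU
      have hA0ord : (A ⟨0, hd⟩).order = ((r + s : ℕ) : ℕ∞) := by rw [hA0eq, order_monomialUnit r s hU]
      have hrs : d < r + s := by
        have h := hpoly0
        rw [hA0ord] at h
        exact_mod_cast h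
      by_cases hr : d ≤ r
      · ---------------------------------------------------------------- curve blow-up `V(x₁, y)`
        right
        refine ⟨0, fun j : Fin d => if (j : ℕ) = 0 then X 0 ^ (r - d) * (X 1 ^ s * U) else 0, ?_, ?_, ?_⟩
        · intro j
          by_cases hj : (j : ℕ) = 0
          · have hj' : j = ⟨0, hd⟩ := Fin.ext hj
            subst hj'
            beta_reduce
            rw [if_pos rfl, hA0eq, show d - ((⟨0, hd⟩ : Fin d) : ℕ) = d by simp,
              show (X 0 : MvPowerSeries (Fin 2) k) ^ d * (X 0 ^ (r - d) * (X 1 ^ s * U)) =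
                X 0 ^ (d + (r - d)) * X 1 ^ s * U by ring, Nat.add_sub_cancel' hr]
          · beta_reduce
            rw [hvan j hj, if_neg hj, mul_zero]
        · intro j
          beta_reduce
          by_cases hj : (j : ℕ) = 0
          · rw [if_pos hj, map_mul, map_mul, map_pow, map_pow, constantCoeff_X, constantCoeff_X]
            rcases Nat.eq_zero_or_pos s with hs0 | hs0
            · rw [zero_pow (by omega : r - d ≠ 0), zero_mul]
            · rw [zero_pow hs0.ne', zero_mul, mul_zero]
          · rw [if_neg hj, map_zero]
        · intro ci hci S hSdef _
          rw [monicForm_eq_of_vanish hd _ (fun j hj => curveCoeff_vanish 0 ci _ j hj)] at hSdef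
          beta_reduce at hSdef
          rw [if_pos rfl, show d - ((⟨0, hd⟩ : Fin d) : ℕ) = d by simp, curveCoeff_monomial 0 1 (by decide)] at hSdef
          have hV : constantCoeff (C (ci ^ d) * C ci ^ (r - d) * TupleGame.slice (0 : Fin 2) (subst
              (CobordantChart.chart (fun l : Fin 2 => if l = 0 then 1 else 0) (fun l : Fin 2 => if l = 0 then ci else 0)) U)) ≠ 0 := by
            rw [constantCoeff_curveUnit]
            exact mul_ne_zero (mul_ne_zero (pow_ne_zero _ hci) (pow_ne_zero _ hci)) hU
          refine good_intro hd A hA0ne _ S hSdef (Or.inr (Or.inl ⟨r - d, s, _, hV, ?_, rfl⟩)) ?_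
          · rintro ⟨h1, h2⟩
            apply hndvd
            refine ⟨?_, h2⟩
            have h := Nat.dvd_add h1 (dvd_refl d)
            rwa [Nat.sub_add_cancel hr] at h
          · rw [order_monomialUnit _ _ hV, hA0ord]
            exact_mod_cast (by omega : r - d + s < r + s)
      by_cases hs : d ≤ s
      · ---------------------------------------------------------------- curve blow-up `V(x₂, y)`
        right
        refine ⟨1, fun j : Fin d => if (j : ℕ) = 0 then X 1 ^ (s - d) * (X 0 ^ r * U) else 0, ?_, ?_, ?_⟩
        · intro j
          by_cases hj : (j : ℕ) = 0
          · have hj' : j = ⟨0, hd⟩ := Fin.ext hj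
            subst hj'
            beta_reduce
            rw [if_pos rfl, hA0eq, show d - ((⟨0, hd⟩ : Fin d) : ℕ) = d by simp,
              show (X 1 : MvPowerSeries (Fin 2) k) ^ d * (X 1 ^ (s - d) * (X 0 ^ r * U)) =
                X 0 ^ r * X 1 ^ (d + (s - d)) * U by ring, Nat.add_sub_cancel' hs]
          · beta_reduce
            rw [hvan j hj, if_neg hj, mul_zero]
        · intro j
          beta_reduce
          by_cases hj : (j : ℕ) = 0
          · rw [if_pos hj, map_mul, map_mul, map_pow, map_pow, constantCoeff_X, constantCoeff_X]
            rcases Nat.eq_zero_or_pos r with hr0 | hr0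
            · rw [zero_pow (by omega : s - d ≠ 0), zero_mul]
            · rw [zero_pow hr0.ne', zero_mul, mul_zero]
          · rw [if_neg hj, map_zero]
        · intro ci hci S hSdef _
          rw [monicForm_eq_of_vanish hd _ (fun j hj => curveCoeff_vanish 1 ci _ j hj)] at hSdef
          beta_reduce at hSdef
          rw [if_pos rfl, show d - ((⟨0, hd⟩ : Fin d) : ℕ) = d by simp, curveCoeff_monomial 1 0 (by decide)] at hSdef
          have hV : constantCoeff (C (ci ^ d) * C ci ^ (s - d) * TupleGame.slice (1 : Fin 2) (subst
              (CobordantChart.chart (fun l : Fin 2 => if l = 1 then 1 else 0) (fun l : Fin 2 => if l = 1 then ci else 0)) U)) ≠ 0 := by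
            rw [constantCoeff_curveUnit]
            exact mul_ne_zero (mul_ne_zero (pow_ne_zero _ hci) (pow_ne_zero _ hci)) hU
          refine good_intro hd A hA0ne _ S hSdef (Or.inr (Or.inl ⟨s - d, r, _, hV, ?_, rfl⟩)) ?_
          · rintro ⟨h1, h2⟩
            apply hndvd
            refine ⟨h2, ?_⟩
            have h := Nat.dvd_add h1 (dvd_refl d)
            rwa [Nat.sub_add_cancel hs] at h
          · rw [order_monomialUnit _ _ hV, hA0ord]
            exact_mod_cast (by omega : s - d + r < r + s)
      ------------------------------------------------------------------ point blow-up (`r, s < d`)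
      rw [not_le] at hr hs
      left
      intro c i₀ hci₀ Bv hBv S hSdef _
      rw [monicForm_eq_of_vanish hd _ (fun j hj => pointCoeff_vanish c i₀ A hvan Bv hBv j hj)] at hSdef
      have hB0 := hBv ⟨0, hd⟩
      rw [hA0eq] at hB0
      have hXB := X_mul_pointBv hd hrs c U (Bv ⟨0, hd⟩) hB0
      rw [hXB, slice_mul, slice_pow, slice_X_zero] at hSdef
      have hi₀ : i₀ = 0 ∨ i₀ = 1 := by fin_cases i₀ <;> simp
      rcases hi₀ with rfl | rfl
      · rw [slice_zero_pointFactor] at hSdef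
        by_cases hc1 : c 1 = 0
        · -- `c = (c₁, 0)`: the monomial case `(r + s - d, s)`
          rw [hc1, map_zero, zero_add, show (X 0 : MvPowerSeries (Fin 2) k) ^ (r + s - d) *
              (C (c 0) ^ r * X 1 ^ s * TupleGame.slice (0 : Fin 2) (subst (CobordantChart.chart (fun _ : Fin 2 => 1) c) U)) =
              X 0 ^ (r + s - d) * X 1 ^ s * (C (c 0) ^ r * TupleGame.slice (0 : Fin 2)
                (subst (CobordantChart.chart (fun _ : Fin 2 => 1) c) U)) by ring] at hSdef
          have hV : constantCoeff (C (c 0) ^ r * TupleGame.slice (0 : Fin 2)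
              (subst (CobordantChart.chart (fun _ : Fin 2 => 1) c) U)) ≠ 0 := by
            rw [map_mul, map_pow, constantCoeff_C, constantCoeff_slice_subst_pointChart]
            exact mul_ne_zero (pow_ne_zero _ hci₀) hU
          refine good_intro hd A hA0ne _ S hSdef (Or.inr (Or.inl ⟨r + s - d, s, _, hV, ?_, rfl⟩)) ?_
          · rintro ⟨-, h2⟩
            have := Nat.eq_zero_of_dvd_of_lt h2 hs
            omega
          · rw [order_monomialUnit _ _ hV, hA0ord]
            exact_mod_cast (by omega : r + s - d + s < r + s)
        · -- both `c₁, c₂ ≠ 0`: the slice has order `r + s - d < d`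
          have hV : constantCoeff (C (c 0) ^ r * (C (c 1) + X 1) ^ s * TupleGame.slice (0 : Fin 2)
              (subst (CobordantChart.chart (fun _ : Fin 2 => 1) c) U)) ≠ 0 := by
            rw [map_mul, map_mul, map_pow, map_pow, map_add, constantCoeff_C, constantCoeff_C, constantCoeff_X, add_zero,
              constantCoeff_slice_subst_pointChart]
            exact mul_ne_zero (mul_ne_zero (pow_ne_zero _ hci₀) (pow_ne_zero _ hc1)) hU
          refine good_intro hd A hA0ne _ S hSdef (Or.inl ?_) ?_
          · rw [order_X_pow_mul, order_eq_zero_of_constantCoeff_ne_zero hV, add_zero]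
            exact_mod_cast (by omega : r + s - d < d)
          · rw [order_X_pow_mul, order_eq_zero_of_constantCoeff_ne_zero hV, add_zero, hA0ord]
            exact_mod_cast (by omega : r + s - d < r + s)
      · rw [slice_one_pointFactor] at hSdef
        by_cases hc0 : c 0 = 0
        · -- `c = (0, c₂)`: the monomial case `(r + s - d, r)`
          rw [hc0, map_zero, zero_add, show (X 0 : MvPowerSeries (Fin 2) k) ^ (r + s - d) *
              (X 1 ^ r * C (c 1) ^ s * TupleGame.slice (1 : Fin 2) (subst (CobordantChart.chart (fun _ : Fin 2 => 1) c) U)) =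
              X 0 ^ (r + s - d) * X 1 ^ r * (C (c 1) ^ s * TupleGame.slice (1 : Fin 2)
                (subst (CobordantChart.chart (fun _ : Fin 2 => 1) c) U)) by ring] at hSdef
          have hV : constantCoeff (C (c 1) ^ s * TupleGame.slice (1 : Fin 2)
              (subst (CobordantChart.chart (fun _ : Fin 2 => 1) c) U)) ≠ 0 := by
            rw [map_mul, map_pow, constantCoeff_C, constantCoeff_slice_subst_pointChart]
            exact mul_ne_zero (pow_ne_zero _ hci₀) hU
          refine good_intro hd A hA0ne _ S hSdef (Or.inr (Or.inl ⟨r + s - d, r, _, hV, ?_, rfl⟩)) ?_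
          · rintro ⟨-, h2⟩
            have := Nat.eq_zero_of_dvd_of_lt h2 hr
            omega
          · rw [order_monomialUnit _ _ hV, hA0ord]
            exact_mod_cast (by omega : r + s - d + r < r + s)
        · have hV : constantCoeff ((C (c 0) + X 1) ^ r * C (c 1) ^ s * TupleGame.slice (1 : Fin 2)
              (subst (CobordantChart.chart (fun _ : Fin 2 => 1) c) U)) ≠ 0 := by
            rw [map_mul, map_mul, map_pow, map_pow, map_add, constantCoeff_C, constantCoeff_C, constantCoeff_X, add_zero,
              constantCoeff_slice_subst_pointChart]
            exact mul_ne_zero (mul_ne_zero (pow_ne_zero _ hc0) (pow_ne_zero _ hci₀)) hU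
          refine good_intro hd A hA0ne _ S hSdef (Or.inl ?_) ?_
          · rw [order_X_pow_mul, order_eq_zero_of_constantCoeff_ne_zero hV, add_zero]
            exact_mod_cast (by omega : r + s - d < d)
          · rw [order_X_pow_mul, order_eq_zero_of_constantCoeff_ne_zero hV, add_zero, hA0ord]
            exact_mod_cast (by omega : r + s - d < r + s)
    · ------------------------------------------------------------------ the SMALL RESIDUAL case: `V(x_i, y)`
      have hgne : g ≠ 0 := ne_zero_of_order_lt hgd
      have hA0ne : A ⟨0, hd⟩ ≠ 0 := by
        rw [hA0eq]
        exact mul_ne_zero (pow_ne_zero _ (X_ne_zero' i)) hgne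
      have hA0ord : (A ⟨0, hd⟩).order = ((d * m : ℕ) : ℕ∞) + g.order := by rw [hA0eq, order_X_pow_mul]
      have hgcc : constantCoeff g = 0 := one_le_order_iff_constCoeff_eq_zero.mp (Order.one_le_iff_pos.mpr hg0)
      right
      refine ⟨i, fun j : Fin d => if (j : ℕ) = 0 then X i ^ (d * (m - 1)) * g else 0, ?_, ?_, ?_⟩
      · intro j
        by_cases hj : (j : ℕ) = 0
        · have hj' : j = ⟨0, hd⟩ := Fin.ext hj
          subst hj'
          beta_reduce
          rw [if_pos rfl, hA0eq, show d - ((⟨0, hd⟩ : Fin d) : ℕ) = d by simp, ← mul_assoc, ← pow_add]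
          congr 2
          rw [Nat.mul_sub_one, Nat.add_sub_cancel' (Nat.le_mul_of_pos_right d hm)]
        · beta_reduce
          rw [hvan j hj, if_neg hj, mul_zero]
      · intro j
        beta_reduce
        by_cases hj : (j : ℕ) = 0
        · rw [if_pos hj, map_mul, hgcc, mul_zero]
        · rw [if_neg hj, map_zero]
      · intro ci hci S hSdef _
        rw [monicForm_eq_of_vanish hd _ (fun j hj => curveCoeff_vanish i ci _ j hj)] at hSdef
        beta_reduce at hSdef
        rw [if_pos rfl, show d - ((⟨0, hd⟩ : Fin d) : ℕ) = d by simp, curveCoeff_residual] at hSdef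
        obtain ⟨hg''0, hg''d⟩ := order_curveResidual i (pow_ne_zero d hci) hci (d * (m - 1)) g hg0 hgd
        -- the order of the new coefficient, in `ℕ`
        have hfin : (C (ci ^ d) * C ci ^ (d * (m - 1)) * TupleGame.slice i (subst (CobordantChart.chart
            (fun l : Fin 2 => if l = i then 1 else 0) (fun l : Fin 2 => if l = i then ci else 0)) g)).order ≠ ⊤ :=
          ne_top_of_lt hg''d
        obtain ⟨o, ho⟩ := ENat.ne_top_iff_exists.mp hfin
        have hod : o < d := by rw [← ho] at hg''d; exact_mod_cast hg''d
        have hlt : ((X 0 : MvPowerSeries (Fin 2) k) ^ (d * (m - 1)) * (C (ci ^ d) * C ci ^ (d * (m - 1)) *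
            TupleGame.slice i (subst (CobordantChart.chart (fun l : Fin 2 => if l = i then 1 else 0)
              (fun l : Fin 2 => if l = i then ci else 0)) g))).order < (A ⟨0, hd⟩).order := by
          rw [order_X_pow_mul, hA0ord, ← ho]
          calc ((d * (m - 1) : ℕ) : ℕ∞) + (o : ℕ∞) = ((d * (m - 1) + o : ℕ) : ℕ∞) := by push_cast; rfl
            _ < ((d * m : ℕ) : ℕ∞) := by
                have : d * (m - 1) + o < d * m := by
                  rw [Nat.mul_sub_one]
                  have := Nat.le_mul_of_pos_right d hm
                  omega
                exact_mod_cast this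
            _ ≤ ((d * m : ℕ) : ℕ∞) + g.order := le_self_add
        by_cases hm1 : m = 1
        · -- last curve blow-up: the order drops below `d`
          refine good_intro hd A hA0ne _ S hSdef (Or.inl ?_) hlt
          subst hm1
          simp only [Nat.sub_self, mul_zero, pow_zero, mul_one, one_mul] at hg''d ⊢
          exact hg''d
        · refine good_intro hd A hA0ne _ S hSdef (Or.inr (Or.inr ⟨0, m - 1, _, by omega, hg''0, hg''d, rfl⟩)) hlt

end Summit.ResolutionOfSingularities.ResolutionOfSingularities.Theorems
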